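import Summits.QuantumFields.YangMills.Theorems.MirrorModularBoostsPlanarSpectralCone
import Summits.QuantumFields.YangMills.Theorems.MirrorModularBoostsMirrorTransport
import Summits.QuantumFields.YangMills.Theorems.PencilRigidityCurvatureKernelBoundKernelOffDiagonalFrames
import Summits.QuantumFields.YangMills.Theorems.CurvatureBoostCovariance.Negative.Unbundled
import Literature.MathematicalPhysics.QuantumFieldTheory.OSReconstructionNoE1Proofs
import HarnessLib

/-!
# The operator cone `H ≥ |Pᵢ|` in every spatial direction (stub `jointSpectralMeasure_cone_allSpatial`)

Support file for crux `stmt-QuantumFields-11686` (`PencilRigidity.NPointIsotropy`), line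
`complex-rotation-bandlimit`, registered stub `jointSpectralMeasure_cone_allSpatial`.

Statement. Let `S₁` be a one-species Schwinger family on `ℝ⁴` with E2 along `e₀` and translations
on `⁰𝒮` (`h : OSReconstructionNoE1 S₁.toLabelled`), E0', E3, invariance on `⁰𝒮` under the proper
signed permutations of the axes (`Hypercubic S₁`) and reflection positivity in the eight frames of the
`(x₀,x₁)`-plane (`EightFrameRP S₁`). Then for every spatial direction `i : Fin 3` and every joint
spectral measure `μ` of `(H, P⃗)` at a vector of the OS Hilbert space, `μ {p | p₀ < |p_{i+1}|} = 0`.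

Proof. Direction `1` is the landed planar-cone theorem of item stmt-QuantumFields-9664 in arrow form
(`PositivityDiscToOperatorCone.planarConeSupport_of_parts` fed with its four landed parts). For a
general direction we TRANSPORT inside the one OS space: a linear isometry `σ` of `ℝ⁴` fixing `e₀` and
leaving `𝔖` invariant on `⁰𝒮` acts on the generators `(n, k, F) ↦ (n, k, F ∘ σ⁻¹)` (time-ordering is
kept, `Θ` and `⊗` commute with the action, and `ΘF* ⊗ G ∈ ⁰𝒮`), preserving the OS form; exactly as
the spatial translations `U(a⃗)` of `OSReconstructionNoE1` this extends to a unitary `U_σ` of `ℋ` with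
`U_σ e^{-tH} = e^{-tH} U_σ` and `U_σ U(a⃗) = U(σa⃗) U_σ` (`exists_unitary`). Hence if `μ` is a joint
spectral measure at `ψ` then `σ⁻¹_* μ` is one at `U_σ⁻¹ ψ` (`⟪σ a, p⟫ = ⟪a, σ⁻¹ p⟫`;
`isJointSpectralMeasure_map_symm`). Taking for `σ` a proper signed permutation with `σ e₀ = e₀`,
`σ e₁ = e_{i+1}` (`CurvatureKernel.exists_signedPerm_frame`), the direction-`1` cone for `σ⁻¹_* μ` is
the direction-`(i+1)` cone for `μ`. No definitions, no notation.

References: K. Osterwalder, R. Schrader, Comm. Math. Phys. 31 (1973) 83–112, §4.1 (4.5);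
J. Glimm, A. Jaffe, Quantum Physics (1987), §6.1 (the unitary implementation of Euclidean
symmetries on the OS space is folklore bookkeeping).
-/

noncomputable section

namespace Summit.QuantumFields.YangMills.Theorems.NPointIsotropy.ComplexRotationBandlimit

open MeasureTheory Complex Set Filter
open scoped InnerProductSpace SchwartzMap ComplexConjugate
open Literature.MathematicalPhysics.QuantumLattice Literature.MathematicalPhysics.AQFT
  Literature.MathematicalPhysics.QuantumFieldTheory
open Literature.MathematicalPhysics.QuantumFieldTheory.OSReconstructionNoE1
open Summit.QuantumFields.YangMills.Theorems.MirrorTransport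

namespace SpatialTransport

universe u

variable {ι : Type u}

/-! ## The action of an isometry fixing `e₀` on the OS generators -/

section Isometry

variable (σ : EuclideanSpace ℝ (Fin 4) ≃ₗᵢ[ℝ] EuclideanSpace ℝ (Fin 4))
  (hσ : σ (EuclideanSpace.single 0 1) = EuclideanSpace.single 0 1)
include hσ

/-- `t e₀` is fixed by an isometry fixing `e₀`. [folklore] -/
theorem map_timeVec (t : ℝ) : σ (SchwingerFamily.timeVec t) = SchwingerFamily.timeVec t := by
  have h1 : (SchwingerFamily.timeVec t : EuclideanSpace ℝ (Fin 4)) = t • EuclideanSpace.single 0 1 := by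
    ext j
    simp [PiLp.single_apply]
  rw [h1, LinearIsometryEquiv.map_smul, hσ]

/-- An isometry fixing `e₀` commutes with taking the spatial part:
`σ (a − a⁰ e₀) = σ a − (σ a)⁰ e₀`. [folklore] -/
theorem map_spatialPart (a : EuclideanSpace ℝ (Fin 4)) : σ (spatialPart 0 a) = spatialPart 0 (σ a) := by
  have h1 : ∀ b : EuclideanSpace ℝ (Fin 4), spatialPart 0 b = b - (b 0) • EuclideanSpace.single 0 1 := by
    intro b
    ext j
    by_cases hj : j = 0
    · subst hj; simp
    · simp [hj]
  rw [h1, h1, map_sub, LinearIsometryEquiv.map_smul, hσ, apply_zero_of_map_single σ hσ a]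

variable (g : Gen ι 4 → Gen ι 4)
  (hg : ∀ p : Gen ι 4, g p = ⟨p.deg, p.lab, linActMulti σ p.fn,
    isTimeOrdered_linActMulti_of_map_single σ hσ p.timeOrdered⟩)
include hg

/-- The action `g : (n, k, F) ↦ (n, k, F ∘ σ⁻¹)` of `σ` on generators commutes with the time
translations `T(t)` (`σ (t e₀) = t e₀`). [folklore] -/
theorem map_timeShiftGen (t : ℝ) (p : Gen ι 4) : g (timeShiftGen t p) = timeShiftGen t (g p) := by
  rw [hg, hg]
  by_cases ht : 0 ≤ t
  · rw [timeShiftGen_of_nonneg ht, timeShiftGen_of_nonneg ht]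
    refine Gen.eq_of_heq rfl HEq.rfl (heq_of_eq ?_)
    change linActMulti σ (translateMulti (SchwingerFamily.timeVec t) p.fn) =
      translateMulti (SchwingerFamily.timeVec t) (linActMulti σ p.fn)
    rw [linActMulti_translateMulti, map_timeVec σ hσ]
  · rw [timeShiftGen_of_neg (not_le.1 ht), timeShiftGen_of_neg (not_le.1 ht)]

/-- The action of `σ` on generators intertwines the spatial translations:
`g ∘ U(a⃗) = U(σ a⃗) ∘ g`. [folklore] -/
theorem map_spaceShiftGen (a : EuclideanSpace ℝ (Fin 4)) (p : Gen ι 4) :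
    g (spaceShiftGen a p) = spaceShiftGen (σ a) (g p) := by
  rw [hg, hg]
  refine Gen.eq_of_heq rfl HEq.rfl (heq_of_eq ?_)
  change linActMulti σ (translateMulti (spatialPart 0 a) p.fn) =
    translateMulti (spatialPart 0 (σ a)) (linActMulti σ p.fn)
  rw [linActMulti_translateMulti, map_spatialPart σ hσ]

/-- **The action preserves the pairing** when `𝔖` is `σ`-invariant on `⁰𝒮`:
`𝔖(Θ(F∘σ⁻¹)* ⊗ (G∘σ⁻¹)) = 𝔖((ΘF* ⊗ G) ∘ σ⁻¹) = 𝔖(ΘF* ⊗ G)` (`Θ` commutes with `σ`, and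
`ΘF* ⊗ G ∈ ⁰𝒮`). [folklore] -/
theorem pairing_map (S : LabelledSchwingerFamily ι (EuclideanSpace ℝ (Fin 4)))
    (hS : ∀ (n : ℕ) (k : Fin n → ι) (F : 𝓢((Fin n → EuclideanSpace ℝ (Fin 4)), ℂ)), IsOffDiagonal F →
      S n k (linActMulti σ F) = S n k F)
    (p q : Gen ι 4) : pairing S (g p) (g q) = pairing S p q := by
  rw [hg, hg]
  change S (p.deg + q.deg) (Fin.append (p.lab ∘ Fin.rev) q.lab)
      ((osAdjoint (linActMulti σ p.fn)).appendTensor (linActMulti σ q.fn)) =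
    S (p.deg + q.deg) (Fin.append (p.lab ∘ Fin.rev) q.lab) ((osAdjoint p.fn).appendTensor q.fn)
  rw [osAdjoint_linActMulti_of_map_single σ hσ, ← linActMulti_appendTensor]
  exact hS _ _ _ (isOffDiagonal_appendTensor_osAdjoint p.timeOrdered q.timeOrdered)

/-- **The action preserves the OS form** on finite combinations of generators (for `σ`-invariant
`𝔖`). [folklore] -/
theorem osForm_mapDomain_map (S : LabelledSchwingerFamily ι (EuclideanSpace ℝ (Fin 4)))
    (hS : ∀ (n : ℕ) (k : Fin n → ι) (F : 𝓢((Fin n → EuclideanSpace ℝ (Fin 4)), ℂ)), IsOffDiagonal F →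
      S n k (linActMulti σ F) = S n k F)
    (v w : Gen ι 4 →₀ ℂ) :
    osForm S (Finsupp.mapDomain g v) (Finsupp.mapDomain g w) = osForm S v w := by
  rw [osForm_mapDomain, osForm_eq_sum]
  refine Finset.sum_congr rfl fun p _ => Finset.sum_congr rfl fun q _ => ?_
  rw [pairing_map σ hσ g hg S hS]

/-- The action commutes with `T(t)` on finite combinations. [folklore] -/
theorem mapDomain_transferPre (t : ℝ) (v : Gen ι 4 →₀ ℂ) :
    Finsupp.mapDomain g (transferPre t v) = transferPre t (Finsupp.mapDomain g v) := by
  simp only [transferPre_apply, ← Finsupp.mapDomain_comp]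
  congr 1
  funext p
  exact map_timeShiftGen σ hσ g hg t p

/-- The action intertwines `U(a⃗)` and `U(σ a⃗)` on finite combinations. [folklore] -/
theorem mapDomain_translatePre (a : EuclideanSpace ℝ (Fin 4)) (v : Gen ι 4 →₀ ℂ) :
    Finsupp.mapDomain g (translatePre a v) = translatePre (σ a) (Finsupp.mapDomain g v) := by
  simp only [translatePre_apply, ← Finsupp.mapDomain_comp]
  congr 1
  funext p
  exact map_spaceShiftGen σ hσ g hg a p

/-- `‖v(g f)‖ = ‖v(f)‖` in the OS Hilbert space. [folklore] -/
theorem norm_vec_mapDomain {S : LabelledSchwingerFamily ι (EuclideanSpace ℝ (Fin 4))}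
    (h : OSReconstructionNoE1 S)
    (hS : ∀ (n : ℕ) (k : Fin n → ι) (F : 𝓢((Fin n → EuclideanSpace ℝ (Fin 4)), ℂ)), IsOffDiagonal F →
      S n k (linActMulti σ F) = S n k F)
    (v : Gen ι 4 →₀ ℂ) : ‖h.vec (Finsupp.mapDomain g v)‖ = ‖h.vec v‖ := by
  rw [← sq_eq_sq₀ (norm_nonneg _) (norm_nonneg _), norm_vec_sq, norm_vec_sq,
    osForm_mapDomain_map σ hσ g hg S hS]

end Isometry

/-! ## The unitary `U_σ` on the OS Hilbert space and the transport of joint spectral measures -/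

/-- **The unitary `U_σ` on `ℋ`** implementing an isometry `σ` fixing `e₀` that leaves `𝔖` invariant
on `⁰𝒮`: there is a linear isometric automorphism `U` of the OS Hilbert space with
`U Ψ_F^{k} = Ψ_{F∘σ⁻¹}^{k}`, `U e^{-tH} = e^{-tH} U` and `U U(a⃗) = U(σ a⃗) U` — the extension by
continuity (`LinearEquiv.extendOfIsometry`) of the relabelling `v(f) ↦ v(g f)`, exactly as
`OSReconstructionNoE1.translate` (Osterwalder–Schrader 1973, (4.5)). [folklore] -/
theorem exists_unitary (σ : EuclideanSpace ℝ (Fin 4) ≃ₗᵢ[ℝ] EuclideanSpace ℝ (Fin 4))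
    (hσ : σ (EuclideanSpace.single 0 1) = EuclideanSpace.single 0 1)
    {S : LabelledSchwingerFamily ι (EuclideanSpace ℝ (Fin 4))} (h : OSReconstructionNoE1 S)
    (hS : ∀ (n : ℕ) (k : Fin n → ι) (F : 𝓢((Fin n → EuclideanSpace ℝ (Fin 4)), ℂ)), IsOffDiagonal F →
      S n k (linActMulti σ F) = S n k F) :
    ∃ U : h.Hilbert ≃ₗᵢ[ℂ] h.Hilbert,
      (∀ (n : ℕ) (k : Fin n → ι) (F : 𝓢((Fin n → EuclideanSpace ℝ (Fin 4)), ℂ)) (hF : IsTimeOrdered F),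
        U (h.fieldVec n k F hF) =
          h.fieldVec n k (linActMulti σ F) (isTimeOrdered_linActMulti_of_map_single σ hσ hF)) ∧
      (∀ (t : ℝ) (ψ : h.Hilbert), U (h.transfer t ψ) = h.transfer t (U ψ)) ∧
      (∀ (a : EuclideanSpace ℝ (Fin 4)) (ψ : h.Hilbert), U (h.translate a ψ) = h.translate (σ a) (U ψ)) := by
  -- the action on generators and its inverse
  obtain ⟨g, hg⟩ : ∃ g : Gen ι 4 → Gen ι 4, ∀ p, g p = ⟨p.deg, p.lab, linActMulti σ p.fn,
      isTimeOrdered_linActMulti_of_map_single σ hσ p.timeOrdered⟩ := ⟨_, fun _ => rfl⟩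
  have hσ' : σ.symm (EuclideanSpace.single 0 1) = EuclideanSpace.single 0 1 := symm_map_single σ hσ
  obtain ⟨g', hg'⟩ : ∃ g' : Gen ι 4 → Gen ι 4, ∀ p, g' p = ⟨p.deg, p.lab, linActMulti σ.symm p.fn,
      isTimeOrdered_linActMulti_of_map_single σ.symm hσ' p.timeOrdered⟩ := ⟨_, fun _ => rfl⟩
  have h1 : ∀ p, g' (g p) = p := fun p => by
    rw [hg, hg']
    refine Gen.eq_of_heq rfl HEq.rfl (heq_of_eq ?_)
    change linActMulti σ.symm (linActMulti σ p.fn) = p.fn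
    ext x
    simp [linActMulti_apply]
  have h2 : ∀ p, g (g' p) = p := fun p => by
    rw [hg', hg]
    refine Gen.eq_of_heq rfl HEq.rfl (heq_of_eq ?_)
    change linActMulti σ (linActMulti σ.symm p.fn) = p.fn
    ext x
    simp [linActMulti_apply]
  -- the relabelling as a linear automorphism of the free module, preserving `‖v(·)‖`
  let e : Gen ι 4 ≃ Gen ι 4 := ⟨g, g', h1, h2⟩
  let L : (Gen ι 4 →₀ ℂ) ≃ₗ[ℂ] (Gen ι 4 →₀ ℂ) := Finsupp.domLCongr e
  have hL : ∀ v, L v = Finsupp.mapDomain g v := fun v => by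
    simp [L, e, Finsupp.domLCongr_apply, Finsupp.equivMapDomain_eq_mapDomain]
  have hnorm : ∀ v, ‖h.vec (L v)‖ = ‖h.vec v‖ := fun v => by
    rw [hL]
    exact norm_vec_mapDomain σ hσ g hg h hS v
  -- its extension by continuity
  obtain ⟨U, hU⟩ : ∃ U : h.Hilbert ≃ₗᵢ[ℂ] h.Hilbert, ∀ v, U (h.vec v) = h.vec (Finsupp.mapDomain g v) :=
    ⟨L.extendOfIsometry h.vec h.vec h.denseRange_vec h.denseRange_vec hnorm, fun v => by
      rw [LinearEquiv.extendOfIsometry_eq, hL]⟩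
  refine ⟨U, fun n k F hF => ?_, fun t ψ => ?_, fun a ψ => ?_⟩
  · show U (h.vec (Finsupp.single ⟨n, k, F, hF⟩ 1)) =
      h.vec (Finsupp.single ⟨n, k, linActMulti σ F, isTimeOrdered_linActMulti_of_map_single σ hσ hF⟩ 1)
    rw [hU, Finsupp.mapDomain_single, hg]
  · refine h.denseRange_vec.induction_on ψ ?_ fun v => ?_
    · exact isClosed_eq (U.continuous.comp (h.transfer t).continuous)
        ((h.transfer t).continuous.comp U.continuous)
    · rw [transfer_vec, hU, hU, transfer_vec, mapDomain_transferPre σ hσ g hg]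
  · refine h.denseRange_vec.induction_on ψ ?_ fun v => ?_
    · exact isClosed_eq (U.continuous.comp (h.translate a).continuous)
        ((h.translate (σ a)).continuous.comp U.continuous)
    · rw [translate_vec, hU, hU, translate_vec, mapDomain_translatePre σ hσ g hg]

/-- **Transport of joint spectral measures**: if `U` is a unitary of the OS space commuting with
`e^{-tH}` and with `U U(a⃗) = U(σ a⃗) U` for an isometry `σ` fixing `e₀`, and `μ` is a joint spectral
measure of `(H, P⃗)` at `ψ`, then the push-forward of `μ` under `σ⁻¹` is one at `U⁻¹ ψ`
(`⟪U⁻¹ψ, e^{-tH} U(a⃗) U⁻¹ψ⟫ = ⟪ψ, e^{-tH} U(σa⃗) ψ⟫` and `⟪σ a, p⟫ = ⟪a, σ⁻¹ p⟫`). [folklore] -/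
theorem isJointSpectralMeasure_map_symm (σ : EuclideanSpace ℝ (Fin 4) ≃ₗᵢ[ℝ] EuclideanSpace ℝ (Fin 4))
    (hσ : σ (EuclideanSpace.single 0 1) = EuclideanSpace.single 0 1)
    {S : LabelledSchwingerFamily ι (EuclideanSpace ℝ (Fin 4))} (h : OSReconstructionNoE1 S)
    (U : h.Hilbert ≃ₗᵢ[ℂ] h.Hilbert)
    (hUt : ∀ (t : ℝ) (ψ : h.Hilbert), U (h.transfer t ψ) = h.transfer t (U ψ))
    (hUa : ∀ (a : EuclideanSpace ℝ (Fin 4)) (ψ : h.Hilbert), U (h.translate a ψ) = h.translate (σ a) (U ψ))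
    {ψ : h.Hilbert} {μ : Measure (EuclideanSpace ℝ (Fin 4))} (hμ : h.IsJointSpectralMeasure ψ μ) :
    h.IsJointSpectralMeasure (U.symm ψ) (μ.map σ.symm.toMeasurableEquiv) := by
  haveI := hμ.isFiniteMeasure
  have h0 : ∀ p : EuclideanSpace ℝ (Fin 4), σ.symm p 0 = p 0 := fun p =>
    apply_zero_of_map_single σ.symm (symm_map_single σ hσ) p
  have hUt' : ∀ (t : ℝ) (φ : h.Hilbert), h.transfer t (U.symm φ) = U.symm (h.transfer t φ) := fun t φ => by
    apply U.injective
    rw [hUt, LinearIsometryEquiv.apply_symm_apply, LinearIsometryEquiv.apply_symm_apply]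
  have hUa' : ∀ (a : EuclideanSpace ℝ (Fin 4)) (φ : h.Hilbert),
      h.translate a (U.symm φ) = U.symm (h.translate (σ a) φ) := fun a φ => by
    apply U.injective
    rw [hUa, LinearIsometryEquiv.apply_symm_apply, LinearIsometryEquiv.apply_symm_apply]
  refine ⟨inferInstance, ?_, fun t ht a ha => ?_⟩
  · rw [MeasurableEquiv.map_apply]
    have h1 : (σ.symm.toMeasurableEquiv : EuclideanSpace ℝ (Fin 4) → EuclideanSpace ℝ (Fin 4)) ⁻¹'
        {p : EuclideanSpace ℝ (Fin 4) | p 0 < 0} = {p | p 0 < 0} := by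
      ext p
      simp only [Set.mem_preimage, Set.mem_setOf_eq, LinearIsometryEquiv.coe_toMeasurableEquiv, h0]
    rw [h1]
    exact hμ.energy_nonneg
  · rw [hUa', hUt', LinearIsometryEquiv.inner_map_map,
      hμ.inner_transfer_translate t ht (σ a) (by rw [apply_zero_of_map_single σ hσ]; exact ha),
      integral_map_equiv]
    refine integral_congr_ae (Eventually.of_forall fun p => ?_)
    simp only [LinearIsometryEquiv.coe_toMeasurableEquiv]
    rw [h0 p, ← σ.inner_map_map a (σ.symm p), LinearIsometryEquiv.apply_symm_apply]

end SpatialTransport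

open SpatialTransport
open Summit.QuantumFields.YangMills.Cruxes.PlanarSpectralCone.PositivityDiscToOperatorCone
  (planarConeSupport_of_parts stub_discSections stub_cone_of_discSections stub_density stub_linearity)

/-- **The operator cone `H ≥ |Pᵢ|` in every spatial direction** (registered stub
`jointSpectralMeasure_cone_allSpatial` of line `complex-rotation-bandlimit`): for a one-species family
on `ℝ⁴` with E2 along `e₀` + translations, E0', E3, `Hypercubic` and `EightFrameRP`, every joint
spectral measure of `(H, P⃗)` is carried by `{p₀ ≥ |p_{i+1}|}`, `i = 0, 1, 2`. Direction `1` is the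
landed planar cone (`planarConeSupport_of_parts` and its four landed parts); direction `i + 1` is its
transport by the unitary `U_σ` of a proper signed permutation `σ` with `σ e₀ = e₀`, `σ e₁ = e_{i+1}`
applied to the push-forward measure `σ⁻¹_* μ` at `U_σ⁻¹ ψ`. [folklore] -/
theorem jointSpectralMeasure_cone_allSpatial : ∀ (S₁ : Literature.MathematicalPhysics.QuantumLattice.SchwingerFamily (EuclideanSpace ℝ (Fin 4))) (h : Literature.MathematicalPhysics.QuantumFieldTheory.OSReconstructionNoE1 S₁.toLabelled), S₁.toLabelled.HasLinearGrowth → S₁.toLabelled.IsSymmetric → Summit.QuantumFields.YangMills.Theorems.CurvatureBoostCovariance.Negative.Hypercubic S₁ → Summit.QuantumFields.YangMills.Theorems.CurvatureBoostCovariance.Negative.EightFrameRP S₁ → ∀ (i : Fin 3) (ψ : h.Hilbert) (μ : MeasureTheory.Measure (EuclideanSpace ℝ (Fin 4))), h.IsJointSpectralMeasure ψ μ → μ {p : EuclideanSpace ℝ (Fin 4) | p 0 < |p i.succ|} = 0 := by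
  intro S₁ h hlg hsym hHyp h8 i ψ μ hμ
  -- a proper signed permutation `P` with `P e₀ = e₀`, `P e₁ = e_{i+1}`
  obtain ⟨P, hdet, hsign, hP0, hP1⟩ := CurvatureKernel.exists_signedPerm_frame (0 : Fin 4) i.succ
    (Fin.succ_ne_zero i).symm (s := 1) (t := 1) (Or.inl rfl) (Or.inl rfl)
  rw [one_smul] at hP0 hP1
  have hS : ∀ (n : ℕ) (k : Fin n → Unit) (F : 𝓢((Fin n → EuclideanSpace ℝ (Fin 4)), ℂ)),
      IsOffDiagonal F → S₁.toLabelled n k (linActMulti P F) = S₁.toLabelled n k F := fun n k F hF => by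
    rw [SchwingerFamily.toLabelled_apply]
    exact hHyp P hdet hsign n F hF
  have htr : ∀ (n : ℕ) (a : EuclideanSpace ℝ (Fin 4)) (F : 𝓢((Fin n → EuclideanSpace ℝ (Fin 4)), ℂ)),
      IsOffDiagonal F → S₁ n (translateMulti a F) = S₁ n F := fun n a F hF => by
    have h1 := h.translationInvariant n (fun _ => ()) a F hF
    rwa [SchwingerFamily.toLabelled_apply] at h1
  -- the unitary `U_P` and the direction-1 cone for the transported pair `(U_P⁻¹ ψ, P⁻¹_* μ)`
  obtain ⟨U, -, hUt, hUa⟩ := exists_unitary P hP0 h hS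
  have hcone := planarConeSupport_of_parts stub_discSections stub_cone_of_discSections stub_density
    stub_linearity S₁ hlg hsym htr h8 h _ _ (isJointSpectralMeasure_map_symm P hP0 h U hUt hUa hμ)
  rw [MeasurableEquiv.map_apply] at hcone
  -- `(P⁻¹ p)⁰ = p⁰`, `(P⁻¹ p)¹ = ⟪P e₁, p⟫ = p_{i+1}`
  have hco : ∀ (v : EuclideanSpace ℝ (Fin 4)) (j : Fin 4), v j = ⟪EuclideanSpace.single j (1 : ℝ), v⟫_ℝ :=
    fun v j => by
      rw [EuclideanSpace.inner_single_left]
      simp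
  have key : ∀ p : EuclideanSpace ℝ (Fin 4), P.symm p 1 = p i.succ := fun p => by
    rw [hco (P.symm p) 1, ← P.inner_map_map, hP1, LinearIsometryEquiv.apply_symm_apply, ← hco]
  have hset : (P.symm.toMeasurableEquiv : EuclideanSpace ℝ (Fin 4) → EuclideanSpace ℝ (Fin 4)) ⁻¹'
      {p : EuclideanSpace ℝ (Fin 4) | p 0 < |p 1|} = {p : EuclideanSpace ℝ (Fin 4) | p 0 < |p i.succ|} := by
    ext p
    simp only [Set.mem_preimage, Set.mem_setOf_eq, LinearIsometryEquiv.coe_toMeasurableEquiv,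
      apply_zero_of_map_single P.symm (symm_map_single P hP0), key]
  rwa [hset] at hcone

end Summit.QuantumFields.YangMills.Theorems.NPointIsotropy.ComplexRotationBandlimit

end
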